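import Mathlib
import Literature.MathematicalPhysics.QuantumFieldTheory.Luscher2010.TrivializingMaps
import Literature.MathematicalPhysics.QuantumFieldTheory.Luscher2010.FlowActionSeries
import Summits.Ventures.LatticeQCDFlow.TrivializingMaps.LuscherSeriesExistence
import Summits.Ventures.LatticeQCDFlow.TrivializingMaps.GradedTheoremA
import Summits.Ventures.LatticeQCDFlow.TrivializingMaps.TruncatedWilsonFlowSampler
import Summits.Ventures.LatticeQCDFlow.TrivializingMaps.FisherRadiusCap
import Summits.Ventures.LatticeQCDFlow.TrivializingMaps.SuBasisExistence
import HarnessLib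

/-!
HONEST FRAMING: exact (Metropolis-corrected) sampling algorithms for lattice gauge theory; figures
of merit are autocorrelation/cost numbers at stated couplings and volumes; no continuum-physics
claim.

# Runbook/HypothesesInhabited — the hypothesis telescopes of THEOREM A / F / F′ / U and of the
log-depth sampler are jointly inhabited; basis-free corollaries (THEORY-1.md §25, review-runbook)

Proposed tree path: `Summits/Ventures/LatticeQCDFlow/Runbook/HypothesesInhabited.lean` (OURS —
venture-side, never `Literature/`; re-cut of theory-1's GEN-16 `SuBasisExistence.lean` per the lead's
COLLISION RULING RT-30 (25): the CONSTRUCTION of a Lüscher basis is the tree's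
`TrivializingMaps.SuBasisExistence` (`stdSuBasis`, instance `nonempty_suBasis`, pub-lqcd lean-2),
imported here; this file keeps only the review-runbook witnesses and basis-free corollaries).

Every headline statement of `TrivializingMaps/` quantifies over an orthonormal basis `B : SuBasis n`
of `𝔰𝔲(n)` (`tr(T^a T^b) = -½ δ^{ab}`, Lüscher App. A (A.1)–(A.2)) and over hypothesis telescopes
(`IsLuscherSeries B S Sk c`, smoothness, flow maps, …). For the review runbook ("are the hypotheses of
the headline theorems jointly satisfiable, i.e. are the theorems non-vacuous?") this file records, as
CLOSED statements:

* `isEmpty_suBasis_index_of_le_one`: for `n ≤ 1` the colour index set of ANY `SuBasis n` is empty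
  (`𝔰𝔲(0) = 𝔰𝔲(1) = 0`), so every per-colour gradient statement (`∀ a : B.ι, …`) is vacuous there —
  the theorems of `TrivializingMaps/` carry content exactly for `n ≥ 2` (scope note);
* BASIS-FREE COROLLARIES (the basis is "used only to run Lüscher's recursion"):
  `wilson_actionZ_zeroFree` — for every `d, n` there is `ρ = ρ(d, n) > 0` such that the `SU(n)`
  Wilson plaquette partition function `Z_L(s) = ∫ D[U] e^{-s S_W}` of EVERY periodic volume `L` has
  no complex zero in `|s| < ρ` (the tree's `wilson_actionZ_zeroFree_uniform d n B` with the basis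
  argument discharged); `wilson_radius_le_norm_of_actionZ_eq_zero'` /
  `wilson_radius_le_norm_of_zeros_accumulate'` — COROLLARY F′ for the Wilson action without the
  basis argument; `theoremA_radius_le_fisherZeros` — THEOREM A's `(ρ, C)` packaged with F′;
* NON-VACUITY OF THE HYPOTHESIS TELESCOPES: `luscher_hypotheses_inhabited` (THEOREM F / F′ / A:
  `IsLuscherSeries B S Sk c`, `S` and all `Sk` smooth — jointly, for every `d, L, n`, with `S = S_W`),
  `luscher_hypotheses_inhabited_smul` (the `β S_W` form used by THEOREM U and the sampler),
  `theoremFprime_hypotheses_inhabited` (all hypotheses of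
  `IsLuscherSeries.radius_le_norm_of_actionZ_eq_zero` except the zero `hz`, jointly, with THEOREM
  A's `(ρ, C)`), `logDepth_hypotheses_inhabited` (series, flow map `Φ` of the truncated generator and
  output law `q` of `logDepthWilsonFlowSampler`, jointly, for every `d, L, n, N, β`).
  WHAT CANNOT BE WITNESSED in the tree: a complex zero `s₀` of some `Z_L` (the hypothesis `hz` of
  THEOREM F′) — no Fisher zero of an `SU(n)` Wilson partition function is certified here
  (THEORY-1.md §13: printed values are quoted with labels only).

No new definitions, no instances, no axioms; every proof is a one-step assembly of tree theorems.

References: M. Lüscher, Comm. Math. Phys. 293 (2010) 899–919, §3.2, §4.3, §4.5(b), App. A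
[key Luscher2010Trivializing]; THEORY-1.md §12 (THEOREM A), §13.1 (THEOREM F′), §25.
-/

open MeasureTheory ProbabilityTheory Complex
open Literature.MathematicalPhysics.QuantumFieldTheory
open Literature.MathematicalPhysics.QuantumFieldTheory.Luscher2010
open Literature.MathematicalPhysics.QuantumFieldTheory.WilsonFlow (coeConfig)
open Summit.Ventures.LatticeQCDFlow.TrivializingMaps
open scoped ComplexConjugate ContDiff

namespace Summit.Ventures.LatticeQCDFlow.Runbook

/-! ## Scope note: the colour index set is empty for `n ≤ 1` -/

section Scope

variable {n : ℕ}

/-- **For `n ≤ 1` every Lüscher basis is EMPTY** (`𝔰𝔲(0) = 𝔰𝔲(1) = 0`, and a generator would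
have `tr(T^a T^a) = -½ ≠ 0`), so all per-colour gradient statements (`∀ a : B.ι, …`) of
`TrivializingMaps/` are vacuous for `SU(0)`, `SU(1)`; they carry content exactly for `n ≥ 2`.
[cite: Luscher2010Trivializing, App. A.1 eqs. (A.1)–(A.2)] -/
theorem isEmpty_suBasis_index_of_le_one (hn : n ≤ 1) (B : SuBasis n) : IsEmpty B.ι := by
  refine ⟨fun a => ?_⟩
  have horth := B.orth a a
  rw [if_pos rfl] at horth
  have hmem := (mem_suAlgebra_iff (B.T a)).mp (B.mem a)
  interval_cases n
  · simp [Matrix.trace] at horth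
  · have ht : B.T a 0 0 = 0 := by simpa [Matrix.trace_fin_one] using hmem.2
    have h0 : (B.T a * B.T a).trace = 0 := by
      rw [Matrix.trace_fin_one, Matrix.mul_apply, Fin.sum_univ_one, ht, mul_zero]
    rw [h0] at horth
    norm_num at horth

/-- For `2 ≤ n` the colour index set of every Lüscher basis is NONEMPTY (the basis spans `𝔰𝔲(n) ≠ 0`:
`diag(i, -i, 0, …, 0) ∈ 𝔰𝔲(n)` is non-zero). [cite: Luscher2010Trivializing, App. A.1 eqs. (A.1)–(A.2)] -/
theorem nonempty_suBasis_index_of_two_le (hn : 2 ≤ n) (B : SuBasis n) : Nonempty B.ι := by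
  by_contra h
  rw [not_nonempty_iff] at h
  -- the non-zero element `X = diag(i, -i, 0, …)` of `𝔰𝔲(n)`
  set i0 : Fin n := ⟨0, by omega⟩ with hi0
  set i1 : Fin n := ⟨1, by omega⟩ with hi1
  have h01 : i0 ≠ i1 := by simp [hi0, hi1, Fin.ext_iff]
  set X : Matrix (Fin n) (Fin n) ℂ :=
    Matrix.diagonal (fun j => if j = i0 then Complex.I else if j = i1 then -Complex.I else 0) with hX
  have hXmem : X ∈ suAlgebra n := by
    rw [mem_suAlgebra_iff]
    refine ⟨?_, ?_⟩
    · rw [hX, Matrix.diagonal_conjTranspose, Matrix.diagonal_neg]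
      congr 1
      funext j
      simp only [Pi.star_apply]
      by_cases hj0 : j = i0
      · simp [hj0, Complex.conj_I]
      · by_cases hj1 : j = i1
        · simp [hj1, h01.symm, Complex.conj_I]
        · simp [hj0, hj1]
    · rw [hX, Matrix.trace_diagonal]
      rw [Finset.sum_eq_add_of_mem i0 i1 (Finset.mem_univ _) (Finset.mem_univ _) h01]
      · simp [h01.symm]
      · intro j _ hj
        simp [hj.1, hj.2]
  obtain ⟨c, hc⟩ := B.span X hXmem
  have hX0 : X = 0 := by
    rw [hc]
    exact Finset.sum_eq_zero fun a _ => (h.false a).elim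
  have : X i0 i0 = 0 := by rw [hX0]; rfl
  simp [hX, Complex.I_ne_zero] at this

end Scope

/-! ## Basis-free corollaries of THEOREM A + COROLLARY F′ -/

section BasisFree

open scoped Matrix Matrix.Norms.Frobenius

variable {d n : ℕ}

/-- **Volume-uniform zero-free disc of the `SU(n)` Wilson partition functions — basis-free.** For
every `d, n` there is `ρ = ρ(d, n) > 0` such that `Z_L(s) = ∫ D[U] e^{-s S_W} ≠ 0` for EVERY periodic
volume `L` and every complex `|s| < ρ` (`S_W = ∑_p Re tr(1 - U_p)`; `s = β/N` conventionally). The tree's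
`wilson_actionZ_zeroFree_uniform d n B` asked for a basis `B` of `𝔰𝔲(n)` "used only to run Lüscher's
recursion"; the tree's `nonempty_suBasis` discharges it. [ours; cf. Luscher2010Trivializing §4.5(b)] -/
theorem wilson_actionZ_zeroFree (d n : ℕ) :
    ∃ ρ : ℝ, 0 < ρ ∧ ∀ (L : ℕ) [NeZero L] (s : ℂ), ‖s‖ < ρ →
      complexMGF (fun U => -ambWilsonAction (coeConfig U))
        (trivialMeasure (Matrix.specialUnitaryGroup (Fin n) ℂ) d L) s ≠ 0 :=
  (nonempty_suBasis n).elim fun B => wilson_actionZ_zeroFree_uniform d n B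

/-- **COROLLARY F′ (Wilson action), basis-free.** Any pair `(ρ, C)` satisfying THEOREM A's
volume-uniform geometric gradient bound (the body of `LuscherGeometricGradientBound d n`) has
`ρ ≤ |s₀|` for every complex zero `s₀` of `Z_L(s) = ∫ D[U] e^{-s S_W}` of every volume `L`.
[cite: Luscher2010Trivializing, §4.5(b)] -/
theorem wilson_radius_le_norm_of_actionZ_eq_zero' {ρ C : ℝ} (hρ : 0 < ρ)
    (hA : ∀ (L : ℕ) [NeZero L] (B : SuBasis n) (Sk : ℕ → AmbConfig d L n → ℝ) (c : ℕ → ℝ),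
      (∀ k, ContDiff ℝ ∞ (Sk k)) → IsLuscherSeries B ambWilsonAction Sk c →
      ∀ (k : ℕ) (U : GaugeConfig d L (Matrix.specialUnitaryGroup (Fin n) ℂ)) (e : Edge d L)
        (a : B.ι), |linkDeriv e (B.T a) (Sk k) (coeConfig U)| ≤ C * ρ⁻¹ ^ k)
    (L : ℕ) [NeZero L] {s₀ : ℂ}
    (hz : complexMGF (fun U => -ambWilsonAction (coeConfig U))
      (trivialMeasure (Matrix.specialUnitaryGroup (Fin n) ℂ) d L) s₀ = 0) : ρ ≤ ‖s₀‖ :=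
  (nonempty_suBasis n).elim fun B => wilson_radius_le_norm_of_actionZ_eq_zero hρ hA B L hz

/-- **COROLLARY F′ (accumulating zeros), basis-free.** If zeros of `(Z_L)_L` accumulate at `s_c`
then every radius `ρ` of a THEOREM-A-type bound obeys `ρ ≤ |s_c|`.
[cite: Luscher2010Trivializing, §4.5(b)] -/
theorem wilson_radius_le_norm_of_zeros_accumulate' {ρ C : ℝ} (hρ : 0 < ρ)
    (hA : ∀ (L : ℕ) [NeZero L] (B : SuBasis n) (Sk : ℕ → AmbConfig d L n → ℝ) (c : ℕ → ℝ),
      (∀ k, ContDiff ℝ ∞ (Sk k)) → IsLuscherSeries B ambWilsonAction Sk c →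
      ∀ (k : ℕ) (U : GaugeConfig d L (Matrix.specialUnitaryGroup (Fin n) ℂ)) (e : Edge d L)
        (a : B.ι), |linkDeriv e (B.T a) (Sk k) (coeConfig U)| ≤ C * ρ⁻¹ ^ k)
    {sc : ℂ}
    (hacc : ∀ r > 0, ∃ (L : ℕ) (_ : NeZero L) (s₀ : ℂ), ‖s₀ - sc‖ < r ∧
      complexMGF (fun U => -ambWilsonAction (coeConfig U))
        (trivialMeasure (Matrix.specialUnitaryGroup (Fin n) ℂ) d L) s₀ = 0) : ρ ≤ ‖sc‖ :=
  (nonempty_suBasis n).elim fun B => wilson_radius_le_norm_of_zeros_accumulate hρ hA B hacc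

/-- THEOREM A's radius is capped by every Fisher zero of every volume — basis-free packaging of
`GradedSeries.luscherGeometricGradientBound_holds` with COROLLARY F′: there are `ρ > 0`, `C` with the
volume-uniform geometric gradient bound AND `ρ ≤ |s₀|` for every zero `s₀` of any `Z_L`.
[cite: Luscher2010Trivializing, §4.5(b)] -/
theorem theoremA_radius_le_fisherZeros (d n : ℕ) :
    ∃ ρ : ℝ, 0 < ρ ∧ ∃ C : ℝ,
      (∀ (L : ℕ) [NeZero L] (B : SuBasis n) (Sk : ℕ → AmbConfig d L n → ℝ) (c : ℕ → ℝ),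
        (∀ k, ContDiff ℝ ∞ (Sk k)) → IsLuscherSeries B ambWilsonAction Sk c →
        ∀ (k : ℕ) (U : GaugeConfig d L (Matrix.specialUnitaryGroup (Fin n) ℂ)) (e : Edge d L)
          (a : B.ι), |linkDeriv e (B.T a) (Sk k) (coeConfig U)| ≤ C * ρ⁻¹ ^ k) ∧
      ∀ (L : ℕ) [NeZero L] (s₀ : ℂ),
        complexMGF (fun U => -ambWilsonAction (coeConfig U))
          (trivialMeasure (Matrix.specialUnitaryGroup (Fin n) ℂ) d L) s₀ = 0 → ρ ≤ ‖s₀‖ := by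
  obtain ⟨ρ, hρ, C, hA⟩ := GradedSeries.luscherGeometricGradientBound_holds d n
  exact ⟨ρ, hρ, C, hA, fun L _ s₀ hz => wilson_radius_le_norm_of_actionZ_eq_zero' hρ hA L hz⟩

end BasisFree

/-! ## Non-vacuity of the hypothesis telescopes of the headline statements -/

section Telescopes

open scoped Matrix Matrix.Norms.Frobenius

/-- **THEOREM F / F′ / A: the hypotheses `h : IsLuscherSeries B S Sk c`, `hS : S smooth`,
`hSk : all Sk smooth` are JOINTLY satisfiable** for every `d, L, n` — by the Wilson plaquette action
and its constructed Lüscher series (`wilsonSk`, `wilsonConst`, file `LuscherSeriesExistence`) over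
the tree's basis `nonempty_suBasis`. [cite: Luscher2010Trivializing, §4.3 eqs. (4.11)–(4.15)] -/
theorem luscher_hypotheses_inhabited (d L n : ℕ) [NeZero L] :
    ∃ (B : SuBasis n) (S : AmbConfig d L n → ℝ) (Sk : ℕ → AmbConfig d L n → ℝ) (c : ℕ → ℝ),
      IsLuscherSeries B S Sk c ∧ ContDiff ℝ ∞ S ∧ (∀ k, ContDiff ℝ ∞ (Sk k)) ∧
        S = ambWilsonAction :=
  (nonempty_suBasis n).elim fun B =>
    ⟨B, ambWilsonAction, wilsonSk d L B, wilsonConst d L B, isLuscherSeries_wilsonSk B,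
      contDiff_ambWilsonAction, contDiff_wilsonSk B, rfl⟩

/-- **THEOREM U / log-depth sampler: the series hypotheses for `β S_W` are jointly satisfiable** for
every `d, L, n, β` (scaling `IsLuscherSeries.smul` of the Wilson series).
[cite: Luscher2010Trivializing, §4.3 eqs. (4.11)–(4.15)] -/
theorem luscher_hypotheses_inhabited_smul (d L n : ℕ) [NeZero L] (β : ℝ) :
    ∃ (B : SuBasis n) (Sk : ℕ → AmbConfig d L n → ℝ) (c : ℕ → ℝ),
      (∀ k, ContDiff ℝ ∞ (Sk k)) ∧ IsLuscherSeries B (fun W => β * ambWilsonAction W) Sk c :=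
  (nonempty_suBasis n).elim fun B =>
    ⟨B, fun k W => β ^ (k + 1) * wilsonSk d L B k W, fun k => β ^ (k + 1) * wilsonConst d L B k,
      fun k => contDiff_const.mul (contDiff_wilsonSk B k), (isLuscherSeries_wilsonSk B).smul β⟩

/-- **THEOREM F′: all hypotheses except the zero `hz` are jointly satisfiable** — for every `d, L, n`
there are `B, S, Sk, c, ρ > 0, C` with `IsLuscherSeries B S Sk c`, `S`, `Sk` smooth and the geometric
gradient bound `|∂^a_e S^{(k)}| ≤ C ρ^{-k}` (THEOREM A supplies `ρ, C` for `S = S_W`). WHAT CANNOT BE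
WITNESSED here: a zero `s₀` of `Z` (`hz`) — no Fisher zero of an `SU(n)` Wilson partition function is
certified in the tree. [cite: Luscher2010Trivializing, §4.5(b)] -/
theorem theoremFprime_hypotheses_inhabited (d L n : ℕ) [NeZero L] :
    ∃ (B : SuBasis n) (S : AmbConfig d L n → ℝ) (Sk : ℕ → AmbConfig d L n → ℝ) (c : ℕ → ℝ)
      (ρ C : ℝ), IsLuscherSeries B S Sk c ∧ ContDiff ℝ ∞ S ∧ (∀ k, ContDiff ℝ ∞ (Sk k)) ∧ 0 < ρ ∧
      ∀ (k : ℕ) (U : GaugeConfig d L (Matrix.specialUnitaryGroup (Fin n) ℂ)) (e : Edge d L)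
        (a : B.ι), |linkDeriv e (B.T a) (Sk k) (coeConfig U)| ≤ C * ρ⁻¹ ^ k := by
  obtain ⟨ρ, hρ, C, hA⟩ := GradedSeries.luscherGeometricGradientBound_holds d n
  obtain ⟨B⟩ := nonempty_suBasis n
  exact ⟨B, ambWilsonAction, wilsonSk d L B, wilsonConst d L B, ρ, C, isLuscherSeries_wilsonSk B,
    contDiff_ambWilsonAction, contDiff_wilsonSk B, hρ,
    hA L B _ _ (contDiff_wilsonSk B) (isLuscherSeries_wilsonSk B)⟩

/-- **Log-depth sampler (`logDepthWilsonFlowSampler`): the non-numeric hypotheses are jointly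
satisfiable** for every `d, L, n`, truncation order `N` and coupling `β` — a basis `B`, a smooth
Lüscher series of `β S_W`, a flow map `Φ` of the truncated generator `-∂ S̃^{[N]}_t` (global
existence, file `TruncatedWilsonFlowSampler`), and its output law `q = (Φ 1)_* D[U]`, a probability
measure. [cite: Luscher2010Trivializing, §3.2 and §4.3] -/
theorem logDepth_hypotheses_inhabited (d L n N : ℕ) [NeZero L] (β : ℝ) :
    ∃ (B : SuBasis n) (Sk : ℕ → AmbConfig d L n → ℝ) (c : ℕ → ℝ)
      (Φ : ℝ → GaugeConfig d L (Matrix.specialUnitaryGroup (Fin n) ℂ) →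
        GaugeConfig d L (Matrix.specialUnitaryGroup (Fin n) ℂ))
      (q : Measure (GaugeConfig d L (Matrix.specialUnitaryGroup (Fin n) ℂ))),
      (∀ k, ContDiff ℝ ∞ (Sk k)) ∧ IsLuscherSeries B (fun W => β * ambWilsonAction W) Sk c ∧
      IsFlowMap (fun t W => -linkGrad B (truncFlowAction Sk t N) W) Φ ∧
      IsProbabilityMeasure q ∧
      q = Measure.map (Φ 1) (trivialMeasure (Matrix.specialUnitaryGroup (Fin n) ℂ) d L) := by
  obtain ⟨B, Sk, c, hSk, hser⟩ := luscher_hypotheses_inhabited_smul d L n β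
  obtain ⟨Φ, hΦ, -, -, hq⟩ := exists_isFlowMap_truncFlowAction B hSk N
  exact ⟨B, Sk, c, Φ, _, hSk, hser, hΦ, hq, rfl⟩

end Telescopes

end Summit.Ventures.LatticeQCDFlow.Runbook
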